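import Summits.BirchSwinnertonDyer.BirchSwinnertonDyer.Theorems.EisensteinPrimesBSDpOnCellCTelescopeBranchFrobeniusConjOfCharpoly
import Literature.NumberTheory.EllipticCurves.TateModuleContinuityProofs
import HarnessLib

/-!
# [telescope — width x2-p2 g24, 2026-08-30] THE WEIGHT-TWO FIBRE CLAUSE (U-fib₀) FROM FROBENIUS DATA: if the reduction `τ₀ = π mod (X)` of a
# branch lattice has the same Frobenius characteristic polynomials as the Tate module `T_pE` off a finite set of places (Hida's (2.1a,b) for
# `f_E` + Eichler–Shimura: `X² − a_ℓ(E)X + ℓ`), and both are semisimple over `Ω`, then `τ₀` is conjugate OVER `Ω` to `T_pE` in any `ℤ_p`-basis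
# — rider (D7₀) of T-An-2ᴴ discharged down to its semisimplicity input (Serre: `V_pE` irreducible for non-CM `E`)
# Crux 4 `BSDpOnCellC` (stmt-BirchSwinnertonDyer-19034), line «telescope» (`--supports`, helper; closes nothing)

WHY: the companion of `…TelescopeBranchMemberFibreOfFrobCharpoly` (p774643) for the `X = 0` fibre. T-An-2ᴴ (U-fib₀) says «`(π σ)(0)` conjugate
over `Ω = ℂ_p` to `LinearMap.toMatrix b b (W.galoisRepTate p σ)` for some `ℤ_p`-basis `b` of `T_pE`»; print gives «`π mod P_{f_E} ≅ π(f_E)`»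
(Hida (2.2c)) with `π(f_E)` characterised by (2.1a,b), and `π(f_E) ≅ V_pE` (Eichler–Shimura/Faltings: same Frobenius characteristic polynomials;
Serre: `V_pE` irreducible). THIS FILE: frame the tree's continuous Tate-module representation (`WeierstrassCurve.tateGaloisRep W p
(W.continuous_galoisRepTate_holds p)`, `ContinuousRep.frame`) in the basis `b`, and apply p774396
`exists_conj_baseChange_of_hasFrobCharpolyAt_padicInt`: **`exists_fib0_conjOver_of_hasFrobCharpolyAt`** — equal Frobenius characteristic
polynomials of `τ₀` and `T_pE` off a finite `S` + semisimplicity of both over a topological field `Ω` of characteristic `0` receiving `ℤ_p`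
continuously ⟹ `(τ₀ σ)^Ω = P · [T_pE(σ)]_b^Ω · P⁻¹`, the (U-fib₀) shape.

CONTENT (namespace `…Theorems.TelescopeBranchZeroFibreOfFrobCharpoly`; THEOREMS ONLY): `coe_tateFrame_apply`, `hasFrobCharpolyAt_tateFrame_iff`,
**`exists_fib0_conjOver_of_hasFrobCharpolyAt`**.

HONEST FRAMING: representation theory over binders; the semisimplicity inputs and the Frobenius data of `T_pE` are HYPOTHESES (cited facts elsewhere
in the tree); constructs no lattice; closes no registered stub, no crux, no summit statement; BSD is proved for no curve by this file. No named fact,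
no definition, no instance, no `sorry`.
References (shape only): [cite: Hida1986, §2 (2.1a) (2.1b), Thm. 2.1 (2.2c) (p. 557)] [cite: SerreAbelianLadic1968, Ch. I §2.3; Ch. IV §2.2]
-/

set_option autoImplicit false
set_option linter.dupNamespace false

noncomputable section

open scoped Classical MatrixGroups
open IsDedekindDomain NumberField Field
open Literature.NumberTheory.GaloisRepresentations Literature.NumberTheory.EllipticCurves
  Summit.BirchSwinnertonDyer.BirchSwinnertonDyer.Theorems.TelescopeBranchFrobeniusConjOfCharpoly

namespace Summit.BirchSwinnertonDyer.BirchSwinnertonDyer.Theorems.TelescopeBranchZeroFibreOfFrobCharpoly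

universe w

variable {p : ℕ} [Fact p.Prime] (W : WeierstrassCurve ℚ)

/-- The matrix of the framed Tate-module representation in the basis `b` is `[T_pE(σ)]_b`. [folklore] -/
theorem coe_tateFrame_apply [Module.Finite ℤ_[p] (W.tateModule p)] [IsModuleTopology ℤ_[p] (W.tateModule p)]
    (b : Module.Basis (Fin 2) ℤ_[p] (W.tateModule p)) (σ : absoluteGaloisGroup ℚ) :
    ((((WeierstrassCurve.tateGaloisRep W p (W.continuous_galoisRepTate_holds p)).frame b σ : GL (Fin 2) ℤ_[p])) :
        Matrix (Fin 2) (Fin 2) ℤ_[p]) = LinearMap.toMatrix b b (W.galoisRepTate p σ) :=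
  ContinuousRep.coe_frame_apply _ b σ

/-- Frobenius characteristic polynomials of the framed Tate module are those of `W.galoisRepTate` (read through the tree's
`GaloisRep.HasFrobCharpolyAt` of `tateGaloisRep`). [folklore] -/
theorem hasFrobCharpolyAt_tateFrame_iff [Module.Finite ℤ_[p] (W.tateModule p)] [IsModuleTopology ℤ_[p] (W.tateModule p)]
    [Module.Free ℤ_[p] (W.tateModule p)]
    (b : Module.Basis (Fin 2) ℤ_[p] (W.tateModule p)) (v : HeightOneSpectrum (𝓞 ℚ)) (Q : Polynomial ℤ_[p]) :
    FramedGaloisRep.HasFrobCharpolyAt v Q ((WeierstrassCurve.tateGaloisRep W p (W.continuous_galoisRepTate_holds p)).frame b) ↔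
      (WeierstrassCurve.tateGaloisRep W p (W.continuous_galoisRepTate_holds p)).HasFrobCharpolyAt v Q :=
  GaloisRep.hasFrobCharpolyAt_frame_iff v _ b Q

set_option maxHeartbeats 800000 in
/-- **The weight-two fibre clause (U-fib₀) from Frobenius data.** Let `τ₀ : Γ_ℚ →ₜ* GL₂(ℤ_p)` (the reduction `π mod (X)` of a branch lattice), `b` a
`ℤ_p`-basis of `T_pE`, and suppose that off a finite `S`, `τ₀` and the (framed) Tate module have the SAME Frobenius characteristic polynomial
`Q_v ∈ ℤ_p[X]`. Let `f : ℤ_p → Ω` be a continuous ring map to a topological field of characteristic `0` (e.g. `Ω = ℂ_p`) such that `τ₀ ⊗ Ω` and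
`T_pE ⊗ Ω` are semisimple. THEN `(τ₀ σ)^Ω = P · [T_pE(σ)]_b^Ω · P⁻¹` for some `P ∈ GL₂(Ω)` — the conjugacy OVER `Ω` of (U-fib₀).
[cite: Hida1986, §2 (2.1a) (2.1b), Thm. 2.1 (2.2c) (p. 557)] [cite: SerreAbelianLadic1968, Ch. I §2.3] -/
theorem exists_fib0_conjOver_of_hasFrobCharpolyAt [Module.Finite ℤ_[p] (W.tateModule p)] [IsModuleTopology ℤ_[p] (W.tateModule p)]
    (τ₀ : FramedGaloisRep ℚ ℤ_[p] 2) (b : Module.Basis (Fin 2) ℤ_[p] (W.tateModule p))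
    (S : Set (HeightOneSpectrum (𝓞 ℚ))) (hS : S.Finite)
    (h : ∀ v : HeightOneSpectrum (𝓞 ℚ), v ∉ S → ∃ Q : Polynomial ℤ_[p],
      τ₀.HasFrobCharpolyAt v Q ∧
        FramedGaloisRep.HasFrobCharpolyAt v Q ((WeierstrassCurve.tateGaloisRep W p (W.continuous_galoisRepTate_holds p)).frame b))
    {Ω : Type w} [Field Ω] [TopologicalSpace Ω] [IsTopologicalRing Ω] [CharZero Ω] (f : ℤ_[p] →+* Ω) (hf : Continuous f)
    (hssτ : (FramedRep.toRepresentation (FramedRep.baseChange f hf τ₀)).IsSemisimpleRepresentation)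
    (hssT : (FramedRep.toRepresentation (FramedRep.baseChange f hf
      ((WeierstrassCurve.tateGaloisRep W p (W.continuous_galoisRepTate_holds p)).frame b))).IsSemisimpleRepresentation) :
    ∃ P : GL (Fin 2) Ω, ∀ σ : absoluteGaloisGroup ℚ,
      (((τ₀ σ : GL (Fin 2) ℤ_[p]) : Matrix (Fin 2) (Fin 2) ℤ_[p]).map f) =
        ((P : GL (Fin 2) Ω) : Matrix (Fin 2) (Fin 2) Ω) *
          (LinearMap.toMatrix b b (W.galoisRepTate p σ)).map f *
          ((P⁻¹ : GL (Fin 2) Ω) : Matrix (Fin 2) (Fin 2) Ω) := by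
  set ρT : FramedGaloisRep ℚ ℤ_[p] 2 := (WeierstrassCurve.tateGaloisRep W p (W.continuous_galoisRepTate_holds p)).frame b with hρT
  have h' : ∀ v : HeightOneSpectrum (𝓞 ℚ), v ∉ S → ∃ Q : Polynomial ℤ_[p],
      FramedGaloisRep.HasFrobCharpolyAt v Q ρT ∧ FramedGaloisRep.HasFrobCharpolyAt v Q τ₀ := by
    intro v hv
    obtain ⟨Q, h1, h2⟩ := h v hv
    exact ⟨Q, h2, h1⟩
  obtain ⟨P, hP⟩ := exists_conj_baseChange_of_hasFrobCharpolyAt_padicInt ρT τ₀ S hS h' f hf hssT hssτ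
  refine ⟨P, fun σ => ?_⟩
  have hσ := congrArg (fun u : GL (Fin 2) Ω => (u : Matrix (Fin 2) (Fin 2) Ω)) (hP σ)
  simp only [Units.val_mul, FramedRep.coe_baseChange_apply] at hσ
  rw [show (((ρT σ : GL (Fin 2) ℤ_[p])) : Matrix (Fin 2) (Fin 2) ℤ_[p]) = LinearMap.toMatrix b b (W.galoisRepTate p σ) from
    coe_tateFrame_apply W b σ] at hσ
  exact hσ

end Summit.BirchSwinnertonDyer.BirchSwinnertonDyer.Theorems.TelescopeBranchZeroFibreOfFrobCharpoly

end
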